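/-
Origin: expansion seat `planner-pub-hodgecm-pv10-g2-0`, handover #1 2026-08-18T07:10:30Z (`HOME/pub-hodgecm-pv10-g2/lean/Pv10g2/UnitLatticeShells.lean`, md5 b4e26bd3, 204 lines);
landed by the gen-7 packager in gate run 25 as `HodgeCM/PerL34/UnitLatticeShells.lean` (verbatim).
-/
/-
Origin: planner-pub-hodgecm-pv10-g2-0 (unit pub-hodgecm-pv10-g2, DAG-NODE PROVER #10 gen 2), HodgeCM
publication cell, 2026-08-18.  WIP module `Pv10g2.UnitLatticeShells`; intended landing
`HodgeCM/PerL34/UnitLatticeShells.lean` (additive leaf; lands after `ArchimedeanShells` (r24)).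
-/
import Mathlib.NumberTheory.NumberField.Units.DirichletTheorem
import Mathlib.Algebra.Module.ZLattice.Basic
import Summits.HodgeConjecture.HodgeCM.PerL34.ArchimedeanShells

/-!
# (UT) proved: the archimedean norm-`c` shell is compact modulo global units

Node N15 (the one print input `NormOneIdeleClassesCompact` of PerL v5 tex l. 311), lineage pv10.
`NormOneFromClassNumber.lean` typed the two classical inputs of the compactness of `C¹_K`,
`IdeleClassNumberFinite K` (CL) and `ArchShellCompactModPrincipal K` (UT), and proved the assembly;
`ArchimedeanShells.lean` reduced (UT) to the log-lattice statement
`∀ c > 0, ∃ B, ∀ a ∈ K_∞^×, ‖a‖ = c → ∃ ε ∈ 𝓞_K^×, a · ε_∞ ∈ archBox K B`.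

This file PROVES that statement in the kernel from Mathlib's Dirichlet unit theorem
(`NumberField.Units.instZLattice_unitLattice`: the logarithmic embedding of `𝓞_K^×` is a full
`ℤ`-lattice in `{x : ℝ^{w ≠ w₀}}`), hence `ArchShellCompactModPrincipal K` holds — Mathlib only, no
cited fact, nothing posited:

* `exists_unit_logEmbedding_dist_le` — a bounded fundamental domain: every `h ∈ logSpace K` is within
  sup-distance `C` of the logarithmic embedding of a global unit (`ZSpan.fract`, `ZSpan.norm_fract_le`
  for the basis `basisUnitLattice K`);
* `exists_units_mul_mem_archBox` — the log-lattice statement above: the coordinates `w ≠ w₀` are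
  controlled by the fundamental domain, the coordinate `w₀` by `∑_w mult w · log ‖a_w‖ = log c` and
  `∑_w mult w · log |ε|_w = 0` (`NumberField.Units.sum_mult_mul_log`);
* `archShellCompactModPrincipal_holds : ArchShellCompactModPrincipal K`.

Classical source of the argument: Cassels–Fröhlich, *Algebraic Number Theory* (1967), Ch. II §18
(unit theorem; closing remark on the compactness of `J_k^1/k^×`) — used as a GUIDE only; every
statement here is kernel-proved.
-/

set_option autoImplicit false

noncomputable section

open NumberField NumberField.InfinitePlace NumberField.Units
  NumberField.Units.dirichletUnitTheorem

namespace NumberField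

variable (K : Type*) [Field K] [NumberField K]

/-! ## Norms of components of principal infinite adeles and of global units -/

omit [NumberField K] in
/-- `‖(x)_w‖ = w x` for `x ∈ K` and an infinite place `w`. -/
theorem norm_algebraMap_infiniteAdeleRing_apply (x : K) (w : InfinitePlace K) :
    ‖(algebraMap K (InfiniteAdeleRing K) x) w‖ = w x := by
  rw [InfiniteAdeleRing.algebraMap_apply]
  have h := InfinitePlace.Completion.norm_coe (v := w) ((WithAbs.equiv w.1).symm x)
  rw [RingEquiv.apply_symm_apply] at h
  exact h

omit [NumberField K] in
/-- The `w`-component of the archimedean part `ε_∞` of a global unit `ε` has norm `w ε`. -/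
theorem norm_unitsToInfUnits_apply (ε : (𝓞 K)ˣ) (w : InfinitePlace K) :
    ‖((unitsToInfUnits K ε : (InfiniteAdeleRing K)ˣ) : InfiniteAdeleRing K) w‖ =
      w (algebraMap (𝓞 K) K ε) :=
  norm_algebraMap_infiniteAdeleRing_apply K (algebraMap (𝓞 K) K ε) w

omit [NumberField K] in
/-- Components of elements of `K_∞^×` have positive norm. -/
theorem norm_apply_pos_of_units (a : (InfiniteAdeleRing K)ˣ) (w : InfinitePlace K) :
    0 < ‖(a : InfiniteAdeleRing K) w‖ := by
  rw [← infUnitsPi_apply_coe K a w]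
  exact norm_pos_iff.mpr (Units.ne_zero _)

omit [NumberField K] in
/-- Components are multiplicative: `(a b)_w = a_w b_w` in `K_∞^×`. -/
theorem units_val_mul_apply (a b : (InfiniteAdeleRing K)ˣ) (w : InfinitePlace K) :
    ((a * b : (InfiniteAdeleRing K)ˣ) : InfiniteAdeleRing K) w =
      (a : InfiniteAdeleRing K) w * (b : InfiniteAdeleRing K) w := rfl

/-! ## A bounded fundamental domain for the unit lattice -/

/-- **Bounded fundamental domain for the unit lattice.**  There is `C ≥ 0` such that every
`h ∈ logSpace K = ℝ^{\{w ≠ w₀\}}` is within sup-distance `C` of the logarithmic embedding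
`(mult w · log |ε|_w)_{w ≠ w₀}` of some global unit `ε`.  (Dirichlet: the unit lattice is a full
`ℤ`-lattice, Mathlib `instZLattice_unitLattice`; `h - ⌊h⌋` lies in the bounded parallelotope of the
basis `basisUnitLattice K`, Mathlib `ZSpan.norm_fract_le`.) -/
theorem exists_unit_logEmbedding_dist_le :
    ∃ C : ℝ, 0 ≤ C ∧ ∀ h : logSpace K, ∃ ε : (𝓞 K)ˣ, ∀ w : {w : InfinitePlace K // w ≠ w₀},
      |h w - logEmbedding K (Additive.ofMul ε) w| ≤ C := by
  classical
  let B := (basisUnitLattice K).ofZLatticeBasis ℝ (unitLattice K)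
  refine ⟨∑ i, ‖B i‖, Finset.sum_nonneg fun i _ => norm_nonneg _, fun h => ?_⟩
  -- `⌊h⌋_B` is a lattice vector, i.e. the logarithmic embedding of a unit
  have hmem : (ZSpan.floor B h : logSpace K) ∈ unitLattice K := by
    rw [← (basisUnitLattice K).ofZLatticeBasis_span ℝ (unitLattice K)]
    exact (ZSpan.floor B h).2
  obtain ⟨x, -, hx⟩ := Submodule.mem_map.1
    (show (ZSpan.floor B h : logSpace K) ∈ Submodule.map (logEmbedding K).toIntLinearMap ⊤ from hmem)
  refine ⟨Additive.toMul x, fun w => ?_⟩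
  have hxw : logEmbedding K (Additive.ofMul (Additive.toMul x)) w = (ZSpan.floor B h : logSpace K) w := by
    rw [ofMul_toMul, ← hx]
    rfl
  calc |h w - logEmbedding K (Additive.ofMul (Additive.toMul x)) w|
        = ‖ZSpan.fract B h w‖ := by rw [hxw, ZSpan.fract_apply, Pi.sub_apply, Real.norm_eq_abs]
    _ ≤ ‖ZSpan.fract B h‖ := norm_le_pi_norm _ w
    _ ≤ ∑ i, ‖B i‖ := ZSpan.norm_fract_le B h

/-! ## The log-lattice form of (UT) -/

/-- **(UT), log-lattice form, PROVED.**  For every `c > 0` there is `B` such that every `a ∈ K_∞^×`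
with `‖a‖ = ∏_w ‖a_w‖^{mult w} = c` is moved by (the archimedean part of) a global unit `ε` into the
box `archBox K B = {∀ w, e^{-B} ≤ ‖·_w‖ ≤ e^{B}}`.  (Only `c > 0` is of interest — for `c ≤ 0` the
hypothesis `‖a‖ = c` is void — but the statement is proved for every real `c`.) -/
theorem exists_units_mul_mem_archBox (c : ℝ) :
    ∃ B : ℝ, ∀ a : (InfiniteAdeleRing K)ˣ, ‖(a : InfiniteAdeleRing K)‖ = c →
      ∃ ε : (𝓞 K)ˣ, a * unitsToInfUnits K ε ∈ archBox K B := by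
  classical
  obtain ⟨C, hC0, hC⟩ := exists_unit_logEmbedding_dist_le K
  set D : ℝ := |Real.log c| + (Fintype.card {w : InfinitePlace K // w ≠ w₀}) * C + C with hD
  refine ⟨D, fun a ha => ?_⟩
  -- the positive vector `u_w = ‖a_w‖` with `∏_w u_w ^ mult w = c`
  set u : InfinitePlace K → ℝ := fun w => ‖(a : InfiniteAdeleRing K) w‖ with hu_def
  have hu : ∀ w, 0 < u w := fun w => norm_apply_pos_of_units K a w
  have hprod : ∏ w, u w ^ w.mult = c := by rw [← ha, InfiniteAdeleRing.norm_def]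
  -- a unit whose logarithmic embedding is close to `-(mult w · log u_w)_w`
  obtain ⟨ε, hε⟩ := hC fun w => -((w.1.mult : ℝ) * Real.log (u w.1))
  refine ⟨ε, ?_⟩
  have hεpos : ∀ w : InfinitePlace K, 0 < w (algebraMap (𝓞 K) K ε) := fun w =>
    Units.pos_at_place ε w
  -- the logarithms `d w = log u_w + log |ε|_w` of the components of `a · ε_∞`
  set d : InfinitePlace K → ℝ := fun w =>
    Real.log (u w) + Real.log (w (algebraMap (𝓞 K) K ε)) with hd
  -- coordinates `w ≠ w₀`
  have h1' : ∀ w : {w : InfinitePlace K // w ≠ w₀}, |(w.1.mult : ℝ) * d w.1| ≤ C := by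
    intro w
    have h := hε w
    simp only [logEmbedding_component] at h
    rw [← abs_neg]
    convert h using 2
    simp only [hd]
    ring
  have h1 : ∀ w : {w : InfinitePlace K // w ≠ w₀}, |d w.1| ≤ C := by
    intro w
    have h := h1' w
    rw [abs_mul, Nat.abs_cast] at h
    have hm : (1 : ℝ) ≤ w.1.mult := one_le_mult
    calc |d w.1| = 1 * |d w.1| := (one_mul _).symm
      _ ≤ (w.1.mult : ℝ) * |d w.1| := by gcongr
      _ ≤ C := h
  -- the sum relation `∑_w mult w · d w = log c`
  have hsum : ∑ w : InfinitePlace K, (w.mult : ℝ) * d w = Real.log c := by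
    have hu' : ∑ w : InfinitePlace K, (w.mult : ℝ) * Real.log (u w) = Real.log c := by
      rw [← hprod, Real.log_prod (s := Finset.univ) (fun w _ => pow_ne_zero _ (hu w).ne')]
      exact Finset.sum_congr rfl fun w _ => (Real.log_pow _ _).symm
    have hε' := sum_mult_mul_log ε
    simp only [hd, mul_add, Finset.sum_add_distrib, hu', hε', add_zero]
  -- coordinate `w₀`
  have h0 : |d w₀| ≤ |Real.log c| + (Fintype.card {w : InfinitePlace K // w ≠ w₀}) * C := by
    rw [Fintype.sum_eq_add_sum_subtype_ne _ w₀] at hsum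
    have hm : (1 : ℝ) ≤ (w₀ : InfinitePlace K).mult := one_le_mult
    have hbound : |∑ w : {w : InfinitePlace K // w ≠ w₀}, (w.1.mult : ℝ) * d w.1| ≤
        (Fintype.card {w : InfinitePlace K // w ≠ w₀}) * C := by
      calc |∑ w : {w : InfinitePlace K // w ≠ w₀}, (w.1.mult : ℝ) * d w.1|
          ≤ ∑ w : {w : InfinitePlace K // w ≠ w₀}, |(w.1.mult : ℝ) * d w.1| :=
            Finset.abs_sum_le_sum_abs _ _
        _ ≤ ∑ _w : {w : InfinitePlace K // w ≠ w₀}, C := Finset.sum_le_sum fun w _ => h1' w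
        _ = (Fintype.card {w : InfinitePlace K // w ≠ w₀}) * C := by
            rw [Finset.sum_const, Finset.card_univ, nsmul_eq_mul]
    have heq : ((w₀ : InfinitePlace K).mult : ℝ) * d w₀ =
        Real.log c - ∑ w : {w : InfinitePlace K // w ≠ w₀}, (w.1.mult : ℝ) * d w.1 := by
      linarith
    calc |d w₀| = 1 * |d w₀| := (one_mul _).symm
      _ ≤ ((w₀ : InfinitePlace K).mult : ℝ) * |d w₀| := by gcongr
      _ = |((w₀ : InfinitePlace K).mult : ℝ) * d w₀| := by rw [abs_mul, Nat.abs_cast]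
      _ = |Real.log c - ∑ w : {w : InfinitePlace K // w ≠ w₀}, (w.1.mult : ℝ) * d w.1| := by
          rw [heq]
      _ ≤ |Real.log c| + |∑ w : {w : InfinitePlace K // w ≠ w₀}, (w.1.mult : ℝ) * d w.1| :=
          abs_sub _ _
      _ ≤ _ := by linarith
  -- all coordinates: `|d w| ≤ D`
  have hall : ∀ w : InfinitePlace K, |d w| ≤ D := by
    intro w
    have hcard : (0 : ℝ) ≤ (Fintype.card {w : InfinitePlace K // w ≠ w₀}) * C :=
      mul_nonneg (Nat.cast_nonneg _) hC0
    by_cases hw : w = w₀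
    · subst hw; linarith
    · have := h1 ⟨w, hw⟩
      linarith [abs_nonneg (Real.log c)]
  -- translate back: `‖(a · ε_∞)_w‖ = exp (d w)`
  intro w
  have hz : ‖((a * unitsToInfUnits K ε : (InfiniteAdeleRing K)ˣ) : InfiniteAdeleRing K) w‖ =
      Real.exp (d w) := by
    rw [units_val_mul_apply, norm_mul, norm_unitsToInfUnits_apply, hd, Real.exp_add,
      Real.exp_log (hu w), Real.exp_log (hεpos w)]
  rw [hz, Real.exp_le_exp, Real.exp_le_exp]
  exact ⟨by linarith [neg_abs_le (d w), hall w], (le_abs_self _).trans (hall w)⟩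

/-- **(UT) holds** (KERNEL, Mathlib only): the archimedean norm-`c` shells are compact modulo
principal ideles. -/
theorem archShellCompactModPrincipal_holds : ArchShellCompactModPrincipal K :=
  archShellCompactModPrincipal_of_archBox K fun c _ => exists_units_mul_mem_archBox K c

end NumberField

end
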